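import Literature.NumberTheory.LFunctions.Zhang2022.KnifeEdgeMuPsiOverhang

/-!
# Zhang (2022), rung F-S3 (Landau–Siegel programme), sub-cell E: the EXIT x2 «μψ one-sided piece, top b > 1»
# as a THRESHOLD (T-1 style) — kernel companions of `barrier/p2/MUPSI-X2.md` (stub S-E-p2-5)

Y. Zhang, *Discrete mean estimates and the Landau–Siegel zero*, arXiv:2211.02515v1 [Zhang2022LandauSiegel] —
an unrefereed manuscript under adjudication. **WHAT THIS IS NOT: not a claim about Theorems 1–2 of
arXiv:2211.02515, about Landau–Siegel zeros, or about Parity; not a COVERAGE statement for the class «μψ, top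
b > 1» (director-frontier §B-multi KILL 2026-08-26T18:10:26Z, consequence (3): exit x2 is LIVE ELSEWHERE, never
re-opened as an `R⁺⁺` row). The programme SEARCHES and TYPES.** Every statement below is an implication or an
equivalence between the bare `Prop`s of ls-Blen-typer-2's vocabulary of record `KnifeEdgeMuPsiOverhang.lean`
(p458584: `MuPsiCloses`, `OneSidedBounded`, `RobustMuPsiMargin`, `oneSidedNormSq`) and the F-S1R kit
(`Repair.OneSidedProfile`, `Repair.topDiagForm`, `Repair.topForm_indefinite`, p430338); nothing is asserted about
the true `(S, M, X)` of the class (registry rows E-072 = diagonal/scale, E-073 = off-diagonal, both open).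

**The threshold (memo MUPSI-X2.md §2).**
* T-μψ-1 `muPsiCloses_iff_exists_offDiag_lt`: the class closes by positivity iff on SOME one-sided profile of
  length `b` the off-diagonal main term is negative and exceeds the diagonal, `Re X(g,g′,g,g′) < −M(g,g′)` — the
  deciding input is E-073 WITH THE LOWERING SIGN; and `muPsiCloses_iff_not_forall_nonneg` (T-1 shape: closes iff
  the completed class functional `M + Re X(·,·)` is NOT `≥ 0` on the class).
* T-μψ-2 `robustMuPsiClosing_iff_robustMargin`: closing against EVERY `C`-bounded off-diagonal world is
  EQUIVALENT to the robust margin `∃ g, M(g,g′) + C·N_b(g)² < 0` (`→`: test the admissible world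
  `X₊(g,g′,·,·) := C·N_b(g)²`; `←`: `muPsiCloses_of_robustMargin`); hence with a diagonal `≥ 0` there is NO robust
  closing (`not_robustMuPsiClosing_of_nonneg`) and there is an admissible world against which the class does not
  close (`exists_bounded_world_not_closing`, the world `X = 0`): a closing μψ design must NAME its `X_μ`.
* Tightness `muPsiCloses_topDiagForm_zero`: with the χψ continued diagonal `Re 𝔅_b` in the `M`-slot and `X = 0`
  the class closes at every `b > 1` (`Repair.topForm_indefinite`) — the `M`-slot's sign is the content of E-072's
  derivation, not automatic; both slots are load-bearing.

References: Zhang, arXiv:2211.02515v1, §2 p. 5 «A heuristic argument», (2.16), §7 Prop 7.1 (7.2)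
[cite: Zhang2022LandauSiegel, §2 p. 5, (2.16), §7 Prop 7.1 (7.2)]; cell files barrier/p2/MUPSI-X2.md v1,
barrier/p5/P-LEN-4.md, obj/EDREGISTRY.md rows E-029/E-032/E-072/E-073/E-085; tree p458584, p430338, p458582 (T-1).
-/

noncomputable section

open Complex Real Set

namespace Literature.NumberTheory.LFunctions.Zhang2022

namespace KnifeEdge

open Repair

variable {b C : ℝ} {M : (ℝ → ℂ) → (ℝ → ℂ) → ℝ} {X : PairFunctional}

/-! ### T-μψ-1: the exact threshold (E-073 with the lowering sign) -/

/-- **T-μψ-1.** The class «μψ one-sided, top `b`» closes by positivity iff on some one-sided profile of length `b`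
the off-diagonal main term is negative and exceeds the diagonal: `Re X(g,g′,g,g′) < −M(g,g′)`.
[cite: Zhang2022LandauSiegel, §2 p. 5, (2.16)] -/
theorem muPsiCloses_iff_exists_offDiag_lt :
    MuPsiCloses b M X ↔ ∃ g g' : ℝ → ℂ, OneSidedProfile b g g' ∧ (X g g' g g').re < -M g g' := by
  constructor
  · rintro ⟨g, g', hg, h⟩
    exact ⟨g, g', hg, by linarith⟩
  · rintro ⟨g, g', hg, h⟩
    exact ⟨g, g', hg, by linarith⟩

/-- **T-μψ-1, T-1 shape.** The class closes iff the completed class functional `M(g,g′) + Re X(g,g′,g,g′)` is NOT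
nonnegative on the one-sided profiles of length `b`. [cite: Zhang2022LandauSiegel, §2 (2.16)] -/
theorem muPsiCloses_iff_not_forall_nonneg :
    MuPsiCloses b M X ↔ ¬ ∀ g g' : ℝ → ℂ, OneSidedProfile b g g' → 0 ≤ M g g' + (X g g' g g').re := by
  constructor
  · rintro ⟨g, g', hg, h⟩ hall
    exact (not_lt.2 (hall g g' hg)) h
  · intro h
    by_contra hc
    apply h
    intro g g' hg
    by_contra hlt
    exact hc ⟨g, g', hg, lt_of_not_ge hlt⟩

/-! ### T-μψ-2: robust closing ⟺ robust margin; no robust closing with a nonnegative diagonal -/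

/-- **T-μψ-2.** For `b ≥ 0`, `C ≥ 0`: the class closes against EVERY `C`-bounded off-diagonal world
(`OneSidedBounded b C X → MuPsiCloses b M X` for all `X`) iff it has the robust margin `RobustMuPsiMargin b C M`
(`∃ g, M(g,g′) + C·N_b(g)² < 0`). The forward direction tests the admissible world `X₊(g,g′,·,·) := C·N_b(g)²`;
the converse is `muPsiCloses_of_robustMargin`. [cite: Zhang2022LandauSiegel, §2 p. 5, (2.16)] -/
theorem robustMuPsiClosing_iff_robustMargin (hb : 0 ≤ b) (hC : 0 ≤ C) :
    (∀ X : PairFunctional, OneSidedBounded b C X → MuPsiCloses b M X) ↔ RobustMuPsiMargin b C M := by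
  constructor
  · intro h
    have hX : OneSidedBounded b C (fun g g' _ _ => ((C * oneSidedNormSq b g g' : ℝ) : ℂ)) := by
      intro g g' _
      rw [Complex.ofReal_re, abs_of_nonneg (mul_nonneg hC (oneSidedNormSq_nonneg hb g g'))]
    obtain ⟨g, g', hg, hlt⟩ := h _ hX
    refine ⟨g, g', hg, ?_⟩
    simpa only [Complex.ofReal_re] using hlt
  · intro h X hX
    exact muPsiCloses_of_robustMargin h hX

/-- **No robust closing with a nonnegative diagonal** (`b ≥ 0`, `C ≥ 0`, `M ≥ 0` on the class): it is NOT the case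
that the class closes against every `C`-bounded off-diagonal world. [cite: Zhang2022LandauSiegel, §2 p. 5, (2.16)] -/
theorem not_robustMuPsiClosing_of_nonneg (hb : 0 ≤ b) (hC : 0 ≤ C)
    (hM : ∀ g g' : ℝ → ℂ, OneSidedProfile b g g' → 0 ≤ M g g') :
    ¬ ∀ X : PairFunctional, OneSidedBounded b C X → MuPsiCloses b M X := fun h =>
  not_robustMuPsiMargin_of_nonneg hb hC hM ((robustMuPsiClosing_iff_robustMargin hb hC).1 h)

/-- **The non-robust sentence.** With `M ≥ 0` on the class, `b ≥ 0`, `C ≥ 0`, there is a `C`-bounded off-diagonal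
world (namely `X = 0`) against which the class does NOT close — a closing μψ design must name its `X_μ` and exhibit
`Re X_μ(g,g) < −M(g)` (T-μψ-1). [cite: Zhang2022LandauSiegel, §2 p. 5, (2.16)] -/
theorem exists_bounded_world_not_closing (hb : 0 ≤ b) (hC : 0 ≤ C)
    (hM : ∀ g g' : ℝ → ℂ, OneSidedProfile b g g' → 0 ≤ M g g') :
    ∃ X : PairFunctional, OneSidedBounded b C X ∧ ¬ MuPsiCloses b M X :=
  ⟨0, oneSidedBounded_zero hb hC, not_muPsiCloses_of_nonneg fun g g' hg => by simpa using hM g g' hg⟩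

/-! ### Tightness: the `M`-slot is load-bearing -/

/-- **Tightness of the diagonal slot.** With the χψ CONTINUED diagonal `M := Re 𝔅_b` (`Repair.topDiagForm b`) in the
`M`-slot and the off-diagonal world `X = 0`, the one-sided class CLOSES at every `b > 1` (the θ_max = 1 knife edge,
`Repair.topForm_indefinite`): nonnegativity of the class diagonal is the content of its derivation (E-072), not
automatic. [cite: Zhang2022LandauSiegel, §7 Prop 7.1 (7.2)] -/
theorem muPsiCloses_topDiagForm_zero (hb : 1 < b) :
    MuPsiCloses b (fun g g' => (topDiagForm b g g').re) 0 := by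
  obtain ⟨g, g', hg, h⟩ := topForm_indefinite hb
  refine ⟨g, g', hg, ?_⟩
  simp only [h, Pi.zero_apply, Complex.zero_re, add_zero]
  norm_num

end KnifeEdge

end Literature.NumberTheory.LFunctions.Zhang2022

end
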